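import Mathlib
import Summits.ValiantsHypothesis.ValiantsHypothesis.Theorems.FifoMatchingNNLinearDegreeCofactorHardBoundaryTests
import HarnessLib

/-!
# Route FifoMatching — crux `NNLinearDegreeCofactorHard` (stmt-ValiantsHypothesis-23918), line
# `internal_cofactor`, stub S2b (ii): THE BOUNDARY TEST ACROSS A BLOCK OF FORCED POPS (design v2, `R ≡ pop`)

Unit (C″) of the S2b(ii) measure design of record, v2 (`Lines/internal_cofactor-S2b-measure-constraints.md` §5 v2:
every defect letter is a POP; openers are never defects).  A colour boundary of the adversary's split read along the
non-defect positions `V` is a pair of consecutive `V`-positions `s′ < s` with `σ s′ ≠ σ s` and ONLY DEFECT POPS strictly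
between them (the adversary can always place its boundaries so; `R` is dense).  Across pops the front of the queue
MOVES, so the landed pair test (`NNMonotoneHard.boundary_test`, adjacent letters) and `boundary_test_across` (pushes
between) do not apply.  In the ORDINARY interface (p3's `AvoidingSpread`: every arc monochromatic, the defect positions
are coloured too) the test nevertheless NEVER becomes void:

* `card_closers_lt_of_pops` — with only pops strictly between `s′ < t`, `#closers<t = #closers<s′ + [W s′ = D] + (t − s′ − 1)`;
* `colour_eq_of_push_of_pops` (U-branch) — if `W s′ = U`, the pop at each in-between position `i` closes the arc of
  rank `q + (i − s′ − 1)` (`q = #closers<s′`), so respect forces `σ(o_{q+(i−s′−1)}) = σ i`;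
* `colour_eq_of_pop_of_pops` (D-branch) — if `W s′ = D`, respect forces `σ(o_q) = σ s′` and `σ(o_{q+(i−s′)}) = σ i`;
* `boundary_test_across_pops` — if BOTH branch conditions hold (as colour conditions on the strict past) then all the
  openers `o_q, …, o_{q+k}` (`k = s − s′ − 1`) have the colour of `s′`, and the pattern `(U, D)` is impossible (the pop at
  `s` would close `o_{q+k}` at a time of the other colour).

So for EVERY past one of the letter patterns `(U,·)`, `(D,·)`, `(U,D)` at `(s′, s)` is excluded: the instantiation
(unit between (A″) and (D″)) defines `π := (U,U)` if the U-branch colour condition fails, `(D,U)` if the D-branch one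
fails, `(U,D)` otherwise, and prices it with `BlockTests.card_filter_blockAvoid_le` (p592179).  In the DEFECT interface
(exempt arcs) the in-between pops carry no constraint and the test CAN be void (both items behind the front of the new
colour) — one more reason the ordinary interface is primary.

Honest framing: bookkeeping for ONE unit of an OPEN stub's measure construction; nothing here proves S2b, the crux,
`NNDivisionHard`, `NNNotVP` or VP ≠ VNP (monotone ≠ general, `Literature.Barriers.ValiantsHypothesis.MonotoneGap`).
No definitions, no named facts.
-/

noncomputable section

-- Sub = Summit single-conjunct layout: the duplicated namespace component is mandated by the tree.
set_option linter.dupNamespace false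

namespace Summit.ValiantsHypothesis.ValiantsHypothesis.Theorems.FifoMatching.NNLinearDegreeCofactorHard.BoundaryTests

open Finset Literature.Computability.AlgebraicComplexity
open Summit.ValiantsHypothesis.ValiantsHypothesis.Theorems.FifoMatching.NNMonotoneHard

variable {M : ℕ} {W : Fin M → Bool}

/-! ### The closer rank across a block of pops -/

/-- **Across a block of pops the closer rank advances by one per letter**: if every letter strictly between
`s′ < t` is a pop, then `#closers<t = #closers<s′ + [W s′ = D] + (t − s′ − 1)`. [folklore] -/
theorem card_closers_lt_of_pops {s' t : Fin M} (hlt : s' < t)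
    (hmid : ∀ i : Fin M, s' < i → i < t → W i = false) :
    ((closerSet W).filter fun i => i < t).card
      = ((closerSet W).filter fun i => i < s').card + (if W s' = false then 1 else 0)
          + ((t : ℕ) - s' - 1) := by
  classical
  have hwin := card_filter_lt_sub (closerSet W) hlt.le
  -- the closers in the window `[s′, t)`: `s′` if it is a closer, and all of `(s′, t)`
  have hset : ((closerSet W).filter fun i => s' ≤ i ∧ i < t) =
      (if W s' = false then {s'} else ∅) ∪ Finset.Ioo s' t := by
    ext i
    simp only [mem_filter, mem_closerSet, mem_union, Finset.mem_Ioo]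
    constructor
    · rintro ⟨hWi, hle, hlt'⟩
      rcases hle.eq_or_lt with h | h
      · subst h
        left
        rw [if_pos hWi]
        exact mem_singleton_self _
      · exact Or.inr ⟨h, hlt'⟩
    · rintro (hi | ⟨h1, h2⟩)
      · split_ifs at hi with hW
        · rw [mem_singleton] at hi
          subst hi
          exact ⟨hW, le_rfl, hlt⟩
        · exact absurd hi (notMem_empty _)
      · exact ⟨hmid i h1 h2, h1.le, h2⟩
  have hdisj : Disjoint (if W s' = false then ({s'} : Finset (Fin M)) else ∅) (Finset.Ioo s' t) := by
    rw [disjoint_left]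
    intro i hi hi'
    rw [Finset.mem_Ioo] at hi'
    split_ifs at hi with hW
    · rw [mem_singleton] at hi
      subst hi
      exact lt_irrefl _ hi'.1
    · exact absurd hi (notMem_empty _)
  rw [hset, card_union_of_disjoint hdisj, Fin.card_Ioo] at hwin
  have hmono := card_filter_lt_mono (closerSet W) hlt.le
  have hst : (s' : ℕ) < t := hlt
  split_ifs at hwin with hW
  · rw [card_singleton] at hwin; rw [if_pos hW]; omega
  · rw [card_empty] at hwin; rw [if_neg hW]; omega

/-! ### The two branches -/

/-- **U-branch.**  If `W s′ = U` and only pops lie strictly between `s′ < s`, then the pop at an in-between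
position `i` closes the arc of rank `q + (i − s′ − 1)` (`q = #closers<s′`); if the FIFO pairing respects `σ`, that
opener has the colour of `i`. [folklore] -/
theorem colour_eq_of_push_of_pops {h : (closerSet W).card = (openerSet W).card} (σ : Fin M → Bool)
    (hresp : ∀ k : Fin (openerSet W).card,
      σ ((openerSet W).orderEmbOfFin rfl k) = σ ((closerSet W).orderEmbOfFin h k))
    {s' s : Fin M} (hmid : ∀ i : Fin M, s' < i → i < s → W i = false)
    (q : ℕ) (hq : q = ((closerSet W).filter fun i => i < s').card) (hU : W s' = true)
    (i : Fin M) (h1 : s' < i) (h2 : i < s)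
    (j : Fin (openerSet W).card) (hj : (j : ℕ) = q + ((i : ℕ) - s' - 1)) :
    σ ((openerSet W).orderEmbOfFin rfl j) = σ i := by
  have hrank := card_closers_lt_of_pops (W := W) h1 (fun i' h1' h2' => hmid i' h1' (h2'.trans h2))
  rw [if_neg (by simp [hU]), add_zero, ← hq] at hrank
  have hc : (closerSet W).orderEmbOfFin h j = i :=
    closer_eq_orderEmbOfFin (hmid i h1 h2) j (by rw [hj, hrank])
  have := hresp j
  rwa [hc] at this

/-- **D-branch, at `s′`.**  If `W s′ = D` then it closes the arc of the front `o_q`, which therefore has the colour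
of `s′`. [folklore] -/
theorem colour_front_eq_of_pop {h : (closerSet W).card = (openerSet W).card} (σ : Fin M → Bool)
    (hresp : ∀ k : Fin (openerSet W).card,
      σ ((openerSet W).orderEmbOfFin rfl k) = σ ((closerSet W).orderEmbOfFin h k))
    {s' : Fin M} (q : ℕ) (hq : q = ((closerSet W).filter fun i => i < s').card) (hD : W s' = false)
    (j : Fin (openerSet W).card) (hj : (j : ℕ) = q) :
    σ ((openerSet W).orderEmbOfFin rfl j) = σ s' := by
  have hc : (closerSet W).orderEmbOfFin h j = s' := closer_eq_orderEmbOfFin hD j (by rw [hj, hq])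
  have := hresp j
  rwa [hc] at this

/-- **D-branch, in between.**  If `W s′ = D` and only pops lie strictly between `s′ < s`, then the pop at an
in-between position `i` closes the arc of rank `q + (i − s′)`, whose opener therefore has the colour of `i`.
[folklore] -/
theorem colour_eq_of_pop_of_pops {h : (closerSet W).card = (openerSet W).card} (σ : Fin M → Bool)
    (hresp : ∀ k : Fin (openerSet W).card,
      σ ((openerSet W).orderEmbOfFin rfl k) = σ ((closerSet W).orderEmbOfFin h k))
    {s' s : Fin M} (hmid : ∀ i : Fin M, s' < i → i < s → W i = false)
    (q : ℕ) (hq : q = ((closerSet W).filter fun i => i < s').card) (hD : W s' = false)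
    (i : Fin M) (h1 : s' < i) (h2 : i < s)
    (j : Fin (openerSet W).card) (hj : (j : ℕ) = q + ((i : ℕ) - s')) :
    σ ((openerSet W).orderEmbOfFin rfl j) = σ i := by
  have hrank := card_closers_lt_of_pops (W := W) h1 (fun i' h1' h2' => hmid i' h1' (h2'.trans h2))
  rw [if_pos hD, ← hq] at hrank
  have hlt : (s' : ℕ) < i := h1
  have hc : (closerSet W).orderEmbOfFin h j = i :=
    closer_eq_orderEmbOfFin (hmid i h1 h2) j (by rw [hj, hrank]; omega)
  have := hresp j
  rwa [hc] at this

/-! ### The test -/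

/-- **The boundary test across a block of forced pops (ordinary interface).**  Let the FIFO pairing of `W`
respect `σ` on every arc, let `s′ < s` carry a colour boundary (`σ s′ ≠ σ s`) with only pops strictly between, and
`q = #closers<s′` with `q + (s − s′)` an arc index.  If the colour conditions of BOTH branches hold — U-branch: the
openers of ranks `q + (i − s′ − 1)` have the colours of the in-between positions `i`; D-branch: `o_q` has the colour of
`s′` and the openers of ranks `q + (i − s′)` have the colours of the `i` — then all of `o_q, …, o_{q+k}`
(`k = s − s′ − 1`) have the colour of `s′`, so the pattern `(W s′, W s) = (U, D)` is impossible: the pop at `s` would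
close `o_{q+k}` at a time of the other colour.  Consequently, for every strict past, one of `(U,·)`
(`colour_eq_of_push_of_pops`), `(D,·)` (`colour_front_eq_of_pop`, `colour_eq_of_pop_of_pops`) or `(U,D)` is excluded.
[folklore] -/
theorem boundary_test_across_pops {h : (closerSet W).card = (openerSet W).card} (σ : Fin M → Bool)
    (hresp : ∀ k : Fin (openerSet W).card,
      σ ((openerSet W).orderEmbOfFin rfl k) = σ ((closerSet W).orderEmbOfFin h k))
    {s' s : Fin M} (hlt : s' < s) (hmid : ∀ i : Fin M, s' < i → i < s → W i = false)
    (hσ : σ s' ≠ σ s) (q : ℕ) (hq : q = ((closerSet W).filter fun i => i < s').card)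
    (hcard : q + ((s : ℕ) - s') < (openerSet W).card)
    (hA : ∀ i : Fin M, s' < i → i < s → ∀ j : Fin (openerSet W).card,
      (j : ℕ) = q + ((i : ℕ) - s' - 1) → σ ((openerSet W).orderEmbOfFin rfl j) = σ i)
    (hB0 : ∀ j : Fin (openerSet W).card, (j : ℕ) = q → σ ((openerSet W).orderEmbOfFin rfl j) = σ s')
    (hB : ∀ i : Fin M, s' < i → i < s → ∀ j : Fin (openerSet W).card,
      (j : ℕ) = q + ((i : ℕ) - s') → σ ((openerSet W).orderEmbOfFin rfl j) = σ i) :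
    (W s', W s) ≠ (true, false) := by
  intro hpair
  have hU : W s' = true := (Prod.mk.injEq _ _ _ _ ▸ hpair).1
  have hD : W s = false := (Prod.mk.injEq _ _ _ _ ▸ hpair).2
  have hst : (s' : ℕ) < s := hlt
  -- all of `o_q, …, o_{q+k}` have the colour of `s′`
  have hchain : ∀ d : ℕ, d ≤ (s : ℕ) - s' - 1 → ∀ j : Fin (openerSet W).card, (j : ℕ) = q + d →
      σ ((openerSet W).orderEmbOfFin rfl j) = σ s' := by
    intro d
    induction d with
    | zero => intro _ j hj; exact hB0 j (by rw [hj]; rfl)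
    | succ d ih =>
      intro hd j hj
      -- the in-between position `i = s′ + d + 1`
      have hiM : (s' : ℕ) + d + 1 < M := by have := s.isLt; omega
      set i : Fin M := ⟨(s' : ℕ) + d + 1, hiM⟩ with hi
      have h1 : s' < i := Fin.lt_def.2 (by simp only [hi, Fin.val_mk]; omega)
      have h2 : i < s := Fin.lt_def.2 (by simp only [hi, Fin.val_mk]; omega)
      -- the opener of rank `q + d`
      have hjd : q + d < (openerSet W).card := by omega
      have e1 := ih (by omega) ⟨q + d, hjd⟩ rfl
      have e2 := hA i h1 h2 ⟨q + d, hjd⟩ (by simp only [hi, Fin.val_mk]; omega)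
      have e3 := hB i h1 h2 j (by rw [hj]; simp only [hi, Fin.val_mk]; omega)
      rw [e3, ← e2, e1]
  -- the pop at `s` closes `o_{q+k}`
  have hrank := card_closers_lt_of_pops (W := W) hlt hmid
  rw [if_neg (by simp [hU]), add_zero, ← hq] at hrank
  have hjk : q + ((s : ℕ) - s' - 1) < (openerSet W).card := by omega
  have hc : (closerSet W).orderEmbOfFin h ⟨q + ((s : ℕ) - s' - 1), hjk⟩ = s :=
    closer_eq_orderEmbOfFin hD _ (by simp only; rw [hrank])
  have hk := hchain ((s : ℕ) - s' - 1) le_rfl ⟨q + ((s : ℕ) - s' - 1), hjk⟩ rfl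
  have := hresp ⟨q + ((s : ℕ) - s' - 1), hjk⟩
  rw [hc, hk] at this
  exact hσ this

end Summit.ValiantsHypothesis.ValiantsHypothesis.Theorems.FifoMatching.NNLinearDegreeCofactorHard.BoundaryTests

end
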